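import Literature.NumberTheory.LFunctions.SaiasWeingartnerTwist
import Mathlib.Analysis.SpecialFunctions.Complex.LogDeriv
import Mathlib.Analysis.Calculus.MeanValue
import HarnessLib

/-!
# Uniform approximation of twisted combinations of Dirichlet `L`-series

Topic `Literature/NumberTheory/LFunctions` (namespace `Literature.NumberTheory.LFunctions`).
Everything in this file is PROVED; there are no definitions and no named facts.

This is the step "because of … the uniform convergence of the infinite products, we can choose
a prime number `p_M ≥ p_L` such that …" of §4 of Saias–Weingartner (Acta Arith. 140 (2009)),
made quantitative and uniform: for the twisted combination
`𝓖(v, s) = ∑_j L(P_j v, s) · L(χ_j v, s)` (a twist `v : ℕ →*₀ ℂ` is completely multiplicative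
and unimodular on the primes; `P_j` are Dirichlet polynomials supported on `n ≤ K`) and
`σ₀ > 1`, `γ > 0`, there are `M` and `δ > 0` such that
`|𝓖(v, s) - 𝓖(u, s)| < γ` whenever `Re s ≥ σ₀` and `|v(p) - u(p)| ≤ δ` for the primes
`p ≤ M` (`SWApprox.exists_approx`). Ingredients: the Euler product
`L(χ v, s) = exp ∑_p -log(1 - χ(p) v(p) p^{-s})` (`SWTwist.exp_tsum_log_eq_LSeries_twist`),
the bounds `|-log(1 - z)| ≤ (3/2)|z|`, `|log(1-z) - log(1-w)| ≤ 2|z - w|` (`|z|, |w| ≤ 1/2`),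
`|e^a - e^b| ≤ 2|e^b| |a-b|` (the last two as in `SaiasWeingartnerTools.lean`, reproved inline to
keep the import graph small), and the smallness of the tails `∑_{p > M} p^{-σ₀}`.

## References

* [SaiasWeingartner2009] E. Saias, A. Weingartner, Acta Arith. 140 (2009), 335–344, §4.
-/

noncomputable section

open Complex Filter Finset LSeries
open scoped Topology

namespace Literature.NumberTheory.LFunctions

namespace SWApprox

/-! ### The Dirichlet-polynomial factor -/

/-- The `L`-series of a sequence supported on `n ≤ K` is a finite sum. [folklore] -/
theorem LSeries_eq_sum_of_support {f : ℕ → ℂ} {K : ℕ} (hK : ∀ n, f n ≠ 0 → n ≤ K) (v : ℕ → ℂ)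
    (s : ℂ) : LSeries (fun n ↦ f n * v n) s = ∑ n ∈ range (K + 1), term (fun n ↦ f n * v n) s n := by
  refine tsum_eq_sum fun n hn ↦ ?_
  rw [mem_range, not_lt] at hn
  have hf : f n = 0 := by
    by_contra h
    have := hK n h
    omega
  rcases eq_or_ne n 0 with rfl | hn0
  · exact term_zero _ _
  · rw [term_of_ne_zero hn0, hf, zero_mul, zero_div]

/-- Norm of one term: `‖(f v)(n) n^{-s}‖ ≤ ‖f n‖` for `Re s ≥ 0` and `‖v n‖ ≤ 1`. [folklore] -/
theorem norm_term_le {f : ℕ → ℂ} {v : ℕ → ℂ} (hv : ∀ n, ‖v n‖ ≤ 1) {s : ℂ} (hs : 0 ≤ s.re)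
    (n : ℕ) : ‖term (fun n ↦ f n * v n) s n‖ ≤ ‖f n‖ := by
  rcases eq_or_ne n 0 with rfl | hn
  · rw [term_zero, norm_zero]; exact norm_nonneg _
  rw [term_of_ne_zero hn, norm_div, norm_mul, norm_natCast_cpow_of_pos (Nat.pos_of_ne_zero hn)]
  have h1 : (1 : ℝ) ≤ (n : ℝ) ^ s.re := Real.one_le_rpow (by exact_mod_cast Nat.pos_of_ne_zero hn) hs
  calc ‖f n‖ * ‖v n‖ / (n : ℝ) ^ s.re ≤ ‖f n‖ * ‖v n‖ := div_le_self (by positivity) h1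
    _ ≤ ‖f n‖ * 1 := mul_le_mul_of_nonneg_left (hv n) (norm_nonneg _)
    _ = ‖f n‖ := mul_one _

/-- **Bound for the Dirichlet polynomial**: `‖L(f v, s)‖ ≤ ∑_{n ≤ K} ‖f n‖`. [folklore] -/
theorem norm_LSeries_le {f : ℕ → ℂ} {K : ℕ} (hK : ∀ n, f n ≠ 0 → n ≤ K) {v : ℕ → ℂ}
    (hv : ∀ n, ‖v n‖ ≤ 1) {s : ℂ} (hs : 0 ≤ s.re) :
    ‖LSeries (fun n ↦ f n * v n) s‖ ≤ ∑ n ∈ range (K + 1), ‖f n‖ := by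
  rw [LSeries_eq_sum_of_support hK]
  exact (norm_sum_le _ _).trans (sum_le_sum fun n _ ↦ norm_term_le hv hs n)

/-- **Lipschitz dependence of the Dirichlet polynomial on the twist**: if `‖v n - u n‖ ≤ n δ`
for `n ≤ K`, then `‖L(f v, s) - L(f u, s)‖ ≤ (∑_{n ≤ K} ‖f n‖) K δ`. [folklore] -/
theorem norm_LSeries_sub_le {f : ℕ → ℂ} {K : ℕ} (hK : ∀ n, f n ≠ 0 → n ≤ K) {u v : ℕ → ℂ}
    {δ : ℝ} (hδ : 0 ≤ δ) (huv : ∀ n, n ≤ K → ‖v n - u n‖ ≤ n * δ) {s : ℂ} (hs : 0 ≤ s.re) :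
    ‖LSeries (fun n ↦ f n * v n) s - LSeries (fun n ↦ f n * u n) s‖ ≤
      (∑ n ∈ range (K + 1), ‖f n‖) * (K * δ) := by
  rw [LSeries_eq_sum_of_support hK, LSeries_eq_sum_of_support hK, ← sum_sub_distrib, sum_mul]
  refine (norm_sum_le _ _).trans (sum_le_sum fun n hn ↦ ?_)
  rw [mem_range] at hn
  have hterm : term (fun n ↦ f n * v n) s n - term (fun n ↦ f n * u n) s n =
      term (fun n ↦ f n * (v n - u n)) s n := by
    rcases eq_or_ne n 0 with rfl | hn0
    · simp [term_zero]
    · rw [term_of_ne_zero hn0, term_of_ne_zero hn0, term_of_ne_zero hn0]; ring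
  rw [hterm]
  rcases eq_or_ne n 0 with rfl | hn0
  · rw [term_zero, norm_zero]; positivity
  rw [term_of_ne_zero hn0, norm_div, norm_mul, norm_natCast_cpow_of_pos (Nat.pos_of_ne_zero hn0)]
  have h1 : (1 : ℝ) ≤ (n : ℝ) ^ s.re :=
    Real.one_le_rpow (by exact_mod_cast Nat.pos_of_ne_zero hn0) hs
  have h2 : ‖v n - u n‖ ≤ K * δ :=
    (huv n (by omega)).trans (mul_le_mul_of_nonneg_right (by exact_mod_cast (by omega : n ≤ K)) hδ)
  calc ‖f n‖ * ‖v n - u n‖ / (n : ℝ) ^ s.re ≤ ‖f n‖ * ‖v n - u n‖ :=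
        div_le_self (by positivity) h1
    _ ≤ ‖f n‖ * (K * δ) := mul_le_mul_of_nonneg_left h2 (norm_nonneg _)

/-! ### The Euler-product factor -/

/-- The local term `‖χ(k) v(k) k^{-s}‖ ≤ 1/2` for a prime `k` and `Re s ≥ 1`. [folklore] -/
theorem norm_local_le_half {N : ℕ} (χ : DirichletCharacter ℂ N) {v : ℕ →*₀ ℂ}
    (hv : ∀ p, p.Prime → ‖v p‖ = 1) {s : ℂ} (hs : 1 ≤ s.re) {k : ℕ} (hk : k.Prime) :
    ‖χ k * v k * (k : ℂ) ^ (-s)‖ ≤ 1 / 2 := by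
  refine (SWTwist.norm_summand_le χ hv s k).trans ?_
  have hk2 : (2 : ℝ) ≤ k := by exact_mod_cast hk.two_le
  calc (k : ℝ) ^ (-s.re) ≤ (k : ℝ) ^ (-(1 : ℝ)) :=
        Real.rpow_le_rpow_of_exponent_le (by linarith) (by linarith)
    _ = (k : ℝ)⁻¹ := Real.rpow_neg_one _
    _ ≤ (2 : ℝ)⁻¹ := inv_anti₀ two_pos hk2
    _ = 1 / 2 := by norm_num

/-- The logarithmic local term is dominated: `‖-log(1 - χ(k)v(k)k^{-s})‖ ≤ (3/2) k^{-σ₀}` for a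
prime `k` and `Re s ≥ σ₀ ≥ 1`. [folklore] -/
theorem norm_log_local_le {N : ℕ} (χ : DirichletCharacter ℂ N) {v : ℕ →*₀ ℂ}
    (hv : ∀ p, p.Prime → ‖v p‖ = 1) {σ₀ : ℝ} (hσ₀ : 1 ≤ σ₀) {s : ℂ} (hs : σ₀ ≤ s.re) {k : ℕ}
    (hk : k.Prime) : ‖-log (1 - χ k * v k * (k : ℂ) ^ (-s))‖ ≤ 3 / 2 * (k : ℝ) ^ (-σ₀) := by
  have hhalf := norm_local_le_half χ hv (hσ₀.trans hs) hk
  rw [norm_neg, sub_eq_add_neg]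
  refine (norm_log_one_add_half_le_self (by rwa [norm_neg])).trans ?_
  rw [norm_neg]
  refine mul_le_mul_of_nonneg_left ((SWTwist.norm_summand_le χ hv s k).trans ?_) (by norm_num)
  exact Real.rpow_le_rpow_of_exponent_le (by exact_mod_cast hk.one_lt.le) (by linarith)

/-- The majorant `k ↦ [k prime] (3/2) k^{-σ₀}` is summable for `σ₀ > 1`. [folklore] -/
theorem summable_majorant {σ₀ : ℝ} (hσ₀ : 1 < σ₀) :
    Summable fun k : ℕ ↦ if k.Prime then 3 / 2 * (k : ℝ) ^ (-σ₀) else 0 := by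
  refine ((Real.summable_nat_rpow.2 (by linarith : -σ₀ < -1)).mul_left (3 / 2)).of_nonneg_of_le
    (fun k ↦ ?_) fun k ↦ ?_
  · split_ifs
    · exact mul_nonneg (by norm_num) (Real.rpow_nonneg (Nat.cast_nonneg _) _)
    · exact le_rfl
  · split_ifs
    · exact le_rfl
    · exact mul_nonneg (by norm_num) (Real.rpow_nonneg (Nat.cast_nonneg _) _)

/-- The logarithmic local terms, as a sequence on `ℕ`, are dominated by the majorant.
[folklore] -/
theorem norm_logTerm_le {N : ℕ} (χ : DirichletCharacter ℂ N) {v : ℕ →*₀ ℂ}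
    (hv : ∀ p, p.Prime → ‖v p‖ = 1) {σ₀ : ℝ} (hσ₀ : 1 ≤ σ₀) {s : ℂ} (hs : σ₀ ≤ s.re) (k : ℕ) :
    ‖(if k.Prime then -log (1 - χ k * v k * (k : ℂ) ^ (-s)) else 0)‖ ≤
      (if k.Prime then 3 / 2 * (k : ℝ) ^ (-σ₀) else 0) := by
  split_ifs with hk
  · exact norm_log_local_le χ hv hσ₀ hs hk
  · rw [norm_zero]

/-- **Euler product of the twisted `L`-series, indexed by `ℕ`**:
`L(χ v, s) = exp (∑_k [k prime] -log(1 - χ(k) v(k) k^{-s}))` for `Re s > 1`. [folklore] -/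
theorem LSeries_twist_eq_exp {N : ℕ} (χ : DirichletCharacter ℂ N) {v : ℕ →*₀ ℂ}
    (hv : ∀ p, p.Prime → ‖v p‖ = 1) {s : ℂ} (hs : 1 < s.re) :
    LSeries (fun n ↦ χ n * v n) s =
      cexp (∑' k : ℕ, if k.Prime then -log (1 - χ k * v k * (k : ℂ) ^ (-s)) else 0) := by
  rw [← SWTwist.exp_tsum_log_eq_LSeries_twist χ hv hs]
  congr 1
  have h := tsum_subtype {p : ℕ | p.Prime} fun k ↦ -log (1 - χ k * v k * (k : ℂ) ^ (-s))
  rw [show (∑' k : ℕ, if k.Prime then -log (1 - χ k * v k * (k : ℂ) ^ (-s)) else 0) =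
    ∑' k : ℕ, {p : ℕ | p.Prime}.indicator (fun k ↦ -log (1 - χ k * v k * (k : ℂ) ^ (-s))) k from
    tsum_congr fun k ↦ by rw [Set.indicator_apply]; by_cases hk : k.Prime <;> simp [hk]]
  exact h

/-- **Bound for the twisted `L`-series**: `‖L(χ v, s)‖ ≤ exp (∑_k [k prime] (3/2) k^{-σ₀})`
for `Re s ≥ σ₀ > 1`. [folklore] -/
theorem norm_LSeries_twist_le {N : ℕ} (χ : DirichletCharacter ℂ N) {v : ℕ →*₀ ℂ}
    (hv : ∀ p, p.Prime → ‖v p‖ = 1) {σ₀ : ℝ} (hσ₀ : 1 < σ₀) {s : ℂ} (hs : σ₀ ≤ s.re) :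
    ‖LSeries (fun n ↦ χ n * v n) s‖ ≤
      Real.exp (∑' k : ℕ, if k.Prime then 3 / 2 * (k : ℝ) ^ (-σ₀) else 0) := by
  rw [LSeries_twist_eq_exp χ hv (lt_of_lt_of_le hσ₀ hs), norm_exp]
  refine Real.exp_le_exp.2 ((re_le_norm _).trans ?_)
  exact tsum_of_norm_bounded (summable_majorant hσ₀).hasSum (norm_logTerm_le χ hv hσ₀.le hs)

/-- **Lipschitz dependence of the twisted `L`-series on the twist.** For `Re s ≥ σ₀ > 1`, twists
`u, v` with `‖v p - u p‖ ≤ δ` for the primes `p ≤ M`, and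
`Δ := 2 (M+1) δ + 2 ε_M ≤ 1` where `ε_M = ∑_{k > M} [k prime] (3/2) k^{-σ₀}`:
`‖L(χ v, s) - L(χ u, s)‖ ≤ 2 exp(∑_k [k prime] (3/2) k^{-σ₀}) Δ`. [folklore] -/
theorem norm_LSeries_twist_sub_le {N : ℕ} (χ : DirichletCharacter ℂ N) {u v : ℕ →*₀ ℂ}
    (hu : ∀ p, p.Prime → ‖u p‖ = 1) (hv : ∀ p, p.Prime → ‖v p‖ = 1) {σ₀ : ℝ} (hσ₀ : 1 < σ₀)
    {s : ℂ} (hs : σ₀ ≤ s.re) {M : ℕ} {δ : ℝ} (hδ : 0 ≤ δ)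
    (huv : ∀ p, p.Prime → p ≤ M → ‖v p - u p‖ ≤ δ)
    (hΔ : 2 * (M + 1) * δ +
      2 * ∑' m : ℕ, (if (m + (M + 1)).Prime then 3 / 2 * ((m + (M + 1) : ℕ) : ℝ) ^ (-σ₀) else 0)
        ≤ 1) :
    ‖LSeries (fun n ↦ χ n * v n) s - LSeries (fun n ↦ χ n * u n) s‖ ≤
      2 * Real.exp (∑' k : ℕ, if k.Prime then 3 / 2 * (k : ℝ) ^ (-σ₀) else 0) *
        (2 * (M + 1) * δ + 2 * ∑' m : ℕ,
          (if (m + (M + 1)).Prime then 3 / 2 * ((m + (M + 1) : ℕ) : ℝ) ^ (-σ₀) else 0)) := by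
  have hs1 : 1 < s.re := lt_of_lt_of_le hσ₀ hs
  -- two Lipschitz bounds (the same as `SWTools.norm_log_one_sub_sub_le`,
  -- `SWTools.norm_exp_sub_exp_le` of `SaiasWeingartnerTools.lean`)
  have hlogLip : ∀ z w : ℂ, ‖z‖ ≤ 1 / 2 → ‖w‖ ≤ 1 / 2 →
      ‖log (1 - z) - log (1 - w)‖ ≤ 2 * ‖z - w‖ := by
    intro z w hz hw
    have hderiv : ∀ x ∈ Metric.closedBall (0 : ℂ) (1 / 2),
        HasDerivWithinAt (fun x ↦ log (1 - x)) ((1 - x)⁻¹ * (-1))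
          (Metric.closedBall (0 : ℂ) (1 / 2)) x := by
      intro x hx
      rw [Metric.mem_closedBall, dist_zero_right] at hx
      have hslit : 1 - x ∈ slitPlane := by
        rw [sub_eq_add_neg]
        exact mem_slitPlane_of_norm_lt_one (by rw [norm_neg]; linarith)
      have h1 : HasDerivAt (fun x : ℂ ↦ 1 - x) (-1) x := (hasDerivAt_id x).const_sub 1
      exact ((Complex.hasDerivAt_log hslit).comp x h1).hasDerivWithinAt
    have hbound : ∀ x ∈ Metric.closedBall (0 : ℂ) (1 / 2), ‖(1 - x)⁻¹ * (-1 : ℂ)‖ ≤ 2 := by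
      intro x hx
      rw [Metric.mem_closedBall, dist_zero_right] at hx
      rw [norm_mul, norm_neg, norm_one, mul_one, norm_inv]
      have h1 : 1 / 2 ≤ ‖1 - x‖ := by
        have := norm_sub_norm_le (1 : ℂ) x
        rw [norm_one] at this
        linarith
      calc ‖1 - x‖⁻¹ ≤ (1 / 2)⁻¹ := inv_anti₀ (by norm_num) h1
        _ = 2 := by norm_num
    have := Convex.norm_image_sub_le_of_norm_hasDerivWithin_le hderiv hbound
      (convex_closedBall 0 _) (by rwa [Metric.mem_closedBall, dist_zero_right])
      (by rwa [Metric.mem_closedBall, dist_zero_right] : z ∈ Metric.closedBall (0 : ℂ) (1 / 2))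
    simpa using this
  have hexpLip : ∀ a b : ℂ, ‖a - b‖ ≤ 1 → ‖cexp a - cexp b‖ ≤ 2 * ‖cexp b‖ * ‖a - b‖ := by
    intro a b h
    have : cexp a - cexp b = cexp b * (cexp (a - b) - 1) := by
      rw [mul_sub, mul_one, ← Complex.exp_add, add_sub_cancel]
    rw [this, norm_mul]
    have := Complex.norm_exp_sub_one_le h
    nlinarith [norm_nonneg (cexp b), norm_nonneg (cexp (a - b) - 1)]
  -- the two logarithmic sequences and the majorant
  set gv : ℕ → ℂ := fun k ↦ if k.Prime then -log (1 - χ k * v k * (k : ℂ) ^ (-s)) else 0 with hgv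
  set gu : ℕ → ℂ := fun k ↦ if k.Prime then -log (1 - χ k * u k * (k : ℂ) ^ (-s)) else 0 with hgu
  set h : ℕ → ℝ := fun k ↦ if k.Prime then 3 / 2 * (k : ℝ) ^ (-σ₀) else 0 with hh
  have hhs : Summable h := summable_majorant hσ₀
  have hgvle : ∀ k, ‖gv k‖ ≤ h k := norm_logTerm_le χ hv hσ₀.le hs
  have hgule : ∀ k, ‖gu k‖ ≤ h k := norm_logTerm_le χ hu hσ₀.le hs
  have hgvs : Summable gv := .of_norm (hhs.of_nonneg_of_le (fun _ ↦ norm_nonneg _) hgvle)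
  have hgus : Summable gu := .of_norm (hhs.of_nonneg_of_le (fun _ ↦ norm_nonneg _) hgule)
  set ε : ℝ := ∑' m : ℕ, h (m + (M + 1)) with hε
  -- tails
  have htv : ‖∑' m, gv (m + (M + 1))‖ ≤ ε :=
    tsum_of_norm_bounded ((summable_nat_add_iff (M + 1)).2 hhs).hasSum fun m ↦ hgvle _
  have htu : ‖∑' m, gu (m + (M + 1))‖ ≤ ε :=
    tsum_of_norm_bounded ((summable_nat_add_iff (M + 1)).2 hhs).hasSum fun m ↦ hgule _
  -- finite part: each term at most `2δ`
  have hfin : ‖∑ k ∈ range (M + 1), (gv k - gu k)‖ ≤ 2 * (M + 1) * δ := by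
    refine (norm_sum_le _ _).trans ?_
    have hterm : ∀ k ∈ range (M + 1), ‖gv k - gu k‖ ≤ 2 * δ := by
      intro k hk
      rw [mem_range] at hk
      simp only [hgv, hgu]
      split_ifs with hkp
      · rw [neg_sub_neg, norm_sub_rev]
        have h1 := norm_local_le_half χ hv hs1.le hkp
        have h2 := norm_local_le_half χ hu hs1.le hkp
        refine (hlogLip _ _ h1 h2).trans ?_
        rw [show χ k * v k * (k : ℂ) ^ (-s) - χ k * u k * (k : ℂ) ^ (-s) =
          (χ k * (k : ℂ) ^ (-s)) * (v k - u k) by ring, norm_mul]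
        have h3 : ‖χ k * (k : ℂ) ^ (-s)‖ ≤ 1 := by
          rw [norm_mul, norm_natCast_cpow_of_pos hkp.pos]
          refine mul_le_one₀ (χ.norm_le_one k) (Real.rpow_nonneg (Nat.cast_nonneg _) _) ?_
          exact Real.rpow_le_one_of_one_le_of_nonpos (by exact_mod_cast hkp.one_lt.le)
            (by rw [neg_re]; linarith)
        have h4 := huv k hkp (by omega)
        nlinarith [norm_nonneg (v k - u k), norm_nonneg (χ k * (k : ℂ) ^ (-s))]
      · rw [sub_zero, norm_zero]; positivity
    refine (sum_le_sum hterm).trans ?_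
    rw [sum_const, card_range, nsmul_eq_mul]
    push_cast
    nlinarith
  -- the difference of the logarithms
  have hdiff : ‖∑' k, gv k - ∑' k, gu k‖ ≤ 2 * (M + 1) * δ + 2 * ε := by
    rw [← hgvs.tsum_sub hgus, ← (hgvs.sub hgus).sum_add_tsum_nat_add (M + 1)]
    refine (norm_add_le _ _).trans (add_le_add hfin ?_)
    have ht : ∑' i, (gv (i + (M + 1)) - gu (i + (M + 1))) =
        ∑' i, gv (i + (M + 1)) - ∑' i, gu (i + (M + 1)) :=
      ((summable_nat_add_iff (M + 1)).2 hgvs).tsum_sub ((summable_nat_add_iff (M + 1)).2 hgus)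
    rw [ht]
    exact (norm_sub_le _ _).trans (by linarith)
  -- exponentiate
  have hB : ‖cexp (∑' k, gu k)‖ ≤ Real.exp (∑' k, h k) := by
    rw [norm_exp]
    exact Real.exp_le_exp.2 ((re_le_norm _).trans (tsum_of_norm_bounded hhs.hasSum hgule))
  have hle1 : ‖∑' k, gv k - ∑' k, gu k‖ ≤ 1 := hdiff.trans hΔ
  have key : ‖cexp (∑' k, gv k) - cexp (∑' k, gu k)‖ ≤
      2 * Real.exp (∑' k, h k) * (2 * (M + 1) * δ + 2 * ε) := by
    refine (hexpLip _ _ hle1).trans ?_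
    have := mul_le_mul hB hdiff (norm_nonneg _) (Real.exp_pos _).le
    nlinarith [this]
  rw [LSeries_twist_eq_exp χ hv hs1, LSeries_twist_eq_exp χ hu hs1]
  simpa only [hgv, hgu, hh] using key

/-! ### Dependence of a twist on its prime values -/

/-- **Two twists close on the primes `p ≤ M` are close on all `n ≤ M`**:
`‖v n - u n‖ ≤ n δ`. [folklore] -/
theorem norm_twist_sub_twist_le {u v : ℕ →*₀ ℂ} (hu : ∀ p, p.Prime → ‖u p‖ = 1)
    (hv : ∀ p, p.Prime → ‖v p‖ = 1) {M : ℕ} {δ : ℝ} (hδ : 0 ≤ δ)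
    (huv : ∀ p, p.Prime → p ≤ M → ‖v p - u p‖ ≤ δ) {n : ℕ} (hn : n ≤ M) :
    ‖v n - u n‖ ≤ n * δ := by
  induction n using induction_on_primes with
  | zero => simp
  | one => simp [hδ]
  | prime_mul p a hp ih =>
    rcases eq_or_ne a 0 with rfl | ha
    · simp
    have ha1 : 1 ≤ a := Nat.one_le_iff_ne_zero.2 ha
    have hpa : p ≤ p * a := Nat.le_mul_of_pos_right p ha1
    have hap : a ≤ p * a := Nat.le_mul_of_pos_left a hp.pos
    have ih' := ih (hap.trans hn)
    have hpδ := huv p hp (hpa.trans hn)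
    rw [map_mul, map_mul]
    have hsplit : v p * v a - u p * u a = (v p - u p) * v a + u p * (v a - u a) := by ring
    rw [hsplit]
    refine (norm_add_le _ _).trans ?_
    rw [norm_mul, norm_mul, hu p hp, SWTwist.norm_twist hv ha, mul_one, one_mul]
    have h2 : (2 : ℝ) ≤ p := by exact_mod_cast hp.two_le
    have ha' : (1 : ℝ) ≤ a := by exact_mod_cast ha1
    have h3 : (2 : ℝ) * a * δ ≤ (p : ℝ) * a * δ :=
      mul_le_mul_of_nonneg_right (mul_le_mul_of_nonneg_right h2 (by positivity)) hδ
    have h4 : δ ≤ (a : ℝ) * δ := le_mul_of_one_le_left hδ ha'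
    push_cast
    linarith

/-! ### The approximation theorem -/

/-- **Uniform approximation of twisted combinations** (the quantitative form of "we can choose
a prime number `p_M ≥ p_L` such that … `< γ/3n`, `Re z ≥ σ - r`" in [SaiasWeingartner2009],
§4): for Dirichlet polynomials `P_j` supported on `n ≤ K`, characters `χ_j`, `σ₀ > 1` and
`γ > 0` there are `M ≥ K` and `δ > 0` such that for all twists `u, v` with `|v(p) - u(p)| ≤ δ`
for the primes `p ≤ M` and all `s` with `Re s ≥ σ₀`,
`|∑_j L(P_j v, s) L(χ_j v, s) - ∑_j L(P_j u, s) L(χ_j u, s)| < γ`.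
[cite: SaiasWeingartner2009, §4] -/
theorem exists_approx {ι : Type*} [Fintype ι] {q : ι → ℕ} (χ : ∀ i, DirichletCharacter ℂ (q i))
    (P : ι → ℕ → ℂ) {K : ℕ} (hK : ∀ i n, P i n ≠ 0 → n ≤ K) {σ₀ : ℝ} (hσ₀ : 1 < σ₀) {γ : ℝ}
    (hγ : 0 < γ) :
    ∃ M : ℕ, K ≤ M ∧ ∃ δ : ℝ, 0 < δ ∧ ∀ (u v : ℕ →*₀ ℂ),
      (∀ p, p.Prime → ‖u p‖ = 1) → (∀ p, p.Prime → ‖v p‖ = 1) →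
      (∀ p, p.Prime → p ≤ M → ‖v p - u p‖ ≤ δ) →
      ∀ s : ℂ, σ₀ ≤ s.re →
        ‖∑ i, LSeries (fun n ↦ P i n * v n) s * LSeries (fun n ↦ χ i n * v n) s -
          ∑ i, LSeries (fun n ↦ P i n * u n) s * LSeries (fun n ↦ χ i n * u n) s‖ < γ := by
  classical
  -- constants
  set C₂ : ℝ := ∑ i, ∑ n ∈ range (K + 1), ‖P i n‖ with hC₂def
  have hC₂ : 0 ≤ C₂ := sum_nonneg fun i _ ↦ sum_nonneg fun n _ ↦ norm_nonneg _
  set h : ℕ → ℝ := fun k ↦ if k.Prime then 3 / 2 * (k : ℝ) ^ (-σ₀) else 0 with hh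
  have hhs : Summable h := summable_majorant hσ₀
  have hh0 : ∀ k, 0 ≤ h k := fun k ↦ by
    simp only [hh]
    split_ifs
    · exact mul_nonneg (by norm_num) (Real.rpow_nonneg (Nat.cast_nonneg _) _)
    · exact le_rfl
  set B : ℝ := Real.exp (∑' k, h k) with hBdef
  have hB : 0 < B := Real.exp_pos _
  have hCB : 0 < C₂ * B + 1 := by positivity
  -- the tail parameter `M`
  set η₀ : ℝ := min (1 / 4) (γ / (16 * (C₂ * B + 1))) with hη₀
  have hη₀pos : 0 < η₀ := lt_min (by norm_num) (by positivity)
  have htail := tendsto_sum_nat_add h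
  have hev := (tendsto_order.1 htail).2 η₀ hη₀pos
  rw [eventually_atTop] at hev
  obtain ⟨M₁, hM₁⟩ := hev
  set M : ℕ := max M₁ K with hMdef
  set ε : ℝ := ∑' m : ℕ, h (m + (M + 1)) with hεdef
  have hεη : ε < η₀ := hM₁ (M + 1) (by omega)
  have hε0 : 0 ≤ ε := tsum_nonneg fun m ↦ hh0 _
  have hε4 : ε ≤ 1 / 4 := hεη.le.trans (min_le_left _ _)
  have hεγ : ε ≤ γ / (16 * (C₂ * B + 1)) := hεη.le.trans (min_le_right _ _)
  -- the closeness parameter `δ`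
  set X : ℝ := 4 * (C₂ * B + 1) * (4 * ((M : ℝ) + 1) + K) with hXdef
  have hX0 : 0 ≤ X := by positivity
  set δ : ℝ := min (1 / (8 * ((M : ℝ) + 1))) (γ / (X + 1)) with hδdef
  have hM0 : (0 : ℝ) < (M : ℝ) + 1 := by positivity
  have hδpos : 0 < δ := lt_min (by positivity) (by positivity)
  have hδ1 : δ ≤ 1 / (8 * ((M : ℝ) + 1)) := min_le_left _ _
  have hδ2 : δ ≤ γ / (X + 1) := min_le_right _ _
  refine ⟨M, le_max_right _ _, δ, hδpos, fun u v hu hv huv s hs ↦ ?_⟩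
  have hs0 : 0 ≤ s.re := by linarith
  set Δ : ℝ := 2 * (M + 1) * δ + 2 * ε with hΔdef
  have hΔ1 : Δ ≤ 1 := by
    have : 2 * ((M : ℝ) + 1) * δ ≤ 1 / 4 := by
      calc 2 * ((M : ℝ) + 1) * δ ≤ 2 * ((M : ℝ) + 1) * (1 / (8 * ((M : ℝ) + 1))) := by gcongr
        _ = 1 / 4 := by field_simp; ring
    rw [hΔdef]; linarith
  have hΔ0 : 0 ≤ Δ := by rw [hΔdef]; positivity
  -- per-index estimate
  have hper : ∀ i, ‖LSeries (fun n ↦ P i n * v n) s * LSeries (fun n ↦ χ i n * v n) s -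
      LSeries (fun n ↦ P i n * u n) s * LSeries (fun n ↦ χ i n * u n) s‖ ≤
      (∑ n ∈ range (K + 1), ‖P i n‖) * B * (2 * Δ + K * δ) := by
    intro i
    set Ci : ℝ := ∑ n ∈ range (K + 1), ‖P i n‖ with hCi
    have hCi0 : 0 ≤ Ci := sum_nonneg fun n _ ↦ norm_nonneg _
    have hv1 : ∀ n, ‖v n‖ ≤ 1 := SWTwist.norm_twist_le hv
    have h1 : ‖LSeries (fun n ↦ P i n * v n) s‖ ≤ Ci := norm_LSeries_le (hK i) hv1 hs0
    have h2 : ‖LSeries (fun n ↦ χ i n * v n) s - LSeries (fun n ↦ χ i n * u n) s‖ ≤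
        2 * B * Δ := norm_LSeries_twist_sub_le (χ i) hu hv hσ₀ hs hδpos.le huv hΔ1
    have h3 : ‖LSeries (fun n ↦ P i n * v n) s - LSeries (fun n ↦ P i n * u n) s‖ ≤
        Ci * (K * δ) :=
      norm_LSeries_sub_le (hK i) hδpos.le (fun n hn ↦ norm_twist_sub_twist_le hu hv hδpos.le huv
        (hn.trans (le_max_right _ _))) hs0
    have h4 : ‖LSeries (fun n ↦ χ i n * u n) s‖ ≤ B := norm_LSeries_twist_le (χ i) hu hσ₀ hs
    have hsplit : LSeries (fun n ↦ P i n * v n) s * LSeries (fun n ↦ χ i n * v n) s -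
        LSeries (fun n ↦ P i n * u n) s * LSeries (fun n ↦ χ i n * u n) s =
        LSeries (fun n ↦ P i n * v n) s *
          (LSeries (fun n ↦ χ i n * v n) s - LSeries (fun n ↦ χ i n * u n) s) +
        (LSeries (fun n ↦ P i n * v n) s - LSeries (fun n ↦ P i n * u n) s) *
          LSeries (fun n ↦ χ i n * u n) s := by ring
    rw [hsplit]
    refine (norm_add_le _ _).trans ?_
    rw [norm_mul, norm_mul]
    have hKδ : 0 ≤ (K : ℝ) * δ := by positivity
    calc ‖LSeries (fun n ↦ P i n * v n) s‖ *
          ‖LSeries (fun n ↦ χ i n * v n) s - LSeries (fun n ↦ χ i n * u n) s‖ +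
        ‖LSeries (fun n ↦ P i n * v n) s - LSeries (fun n ↦ P i n * u n) s‖ *
          ‖LSeries (fun n ↦ χ i n * u n) s‖
        ≤ Ci * (2 * B * Δ) + Ci * (K * δ) * B := by
          gcongr
      _ = Ci * B * (2 * Δ + K * δ) := by ring
  -- sum over the indices
  rw [← sum_sub_distrib]
  refine lt_of_le_of_lt ((norm_sum_le _ _).trans (sum_le_sum fun i _ ↦ hper i)) ?_
  rw [← sum_mul, ← sum_mul]
  -- numerics
  have hK0 : (0 : ℝ) ≤ K := Nat.cast_nonneg _
  have hCB0 : 0 ≤ C₂ * B := by positivity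
  have hA : C₂ * B * (4 * ε) ≤ γ / 4 := by
    calc C₂ * B * (4 * ε) ≤ C₂ * B * (4 * (γ / (16 * (C₂ * B + 1)))) :=
          mul_le_mul_of_nonneg_left (by linarith) hCB0
      _ ≤ (C₂ * B + 1) * (4 * (γ / (16 * (C₂ * B + 1)))) :=
          mul_le_mul_of_nonneg_right (by linarith) (by positivity)
      _ = γ / 4 := by field_simp; ring
  have hBδ : C₂ * B * ((4 * (M + 1) + K) * δ) < γ / 4 + γ / 4 := by
    have hMK : (0 : ℝ) ≤ 4 * ((M : ℝ) + 1) + K := by positivity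
    calc C₂ * B * ((4 * (M + 1) + K) * δ)
        ≤ C₂ * B * ((4 * ((M : ℝ) + 1) + K) * (γ / (X + 1))) :=
          mul_le_mul_of_nonneg_left (mul_le_mul_of_nonneg_left hδ2 hMK) hCB0
      _ ≤ (C₂ * B + 1) * ((4 * ((M : ℝ) + 1) + K) * (γ / (X + 1))) :=
          mul_le_mul_of_nonneg_right (by linarith) (by positivity)
      _ = γ / 4 * (X / (X + 1)) := by rw [hXdef]; field_simp
      _ ≤ γ / 4 * 1 :=
          mul_le_mul_of_nonneg_left ((div_le_one (by positivity)).2 (by linarith)) (by positivity)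
      _ < γ / 4 + γ / 4 := by linarith
  calc C₂ * B * (2 * Δ + K * δ) = C₂ * B * (4 * ε) + C₂ * B * ((4 * (M + 1) + K) * δ) := by
        rw [hΔdef]; ring
    _ < γ / 4 + (γ / 4 + γ / 4) := add_lt_add_of_le_of_lt hA hBδ
    _ < γ := by linarith

end SWApprox

end Literature.NumberTheory.LFunctions
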